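import Mathlib
import HarnessLib
import Summits.NavierStokesRegularity.NavierStokesRegularity.Theses.AxisTwistDoor
import Summits.NavierStokesRegularity.NavierStokesRegularity.Theorems.AxisTwistDoorAveragedConeLiouvilleDefs
import Summits.NavierStokesRegularity.NavierStokesRegularity.Theorems.AxisTwistDoorAveragedConeLiouvilleCircleToolkit
import Summits.NavierStokesRegularity.NavierStokesRegularity.Theorems.AxisTwistDoorAveragedConeLiouvilleCircleSwirl
import Summits.NavierStokesRegularity.NavierStokesRegularity.Theorems.AxisTwistDoorAveragedConeLiouvilleZoomToSlackFree
import Summits.NavierStokesRegularity.NavierStokesRegularity.Theorems.AxisTwistDoorAveragedConeLiouvilleShellBookkeeping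
import Summits.NavierStokesRegularity.NavierStokesRegularity.Theorems.AxisTwistDoorAveragedConeLiouvilleShellCore
import Summits.NavierStokesRegularity.NavierStokesRegularity.Theorems.AxisTwistDoorAveragedConeLiouvillePositivityOfNU
import Summits.NavierStokesRegularity.NavierStokesRegularity.Theorems.AxisTwistDoorAveragedConeLiouvilleRegularOfFluxDecay
import Summits.NavierStokesRegularity.NavierStokesRegularity.Theorems.AxisTwistDoorAveragedConeLiouvilleRescale
import Summits.NavierStokesRegularity.NavierStokesRegularity.Theorems.AxisTwistDoorAveragedConeLiouvilleUnitContraction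
import Summits.NavierStokesRegularity.NavierStokesRegularity.Theorems.AxisTwistDoorAveragedConeLiouvilleHarnackDefs
import Summits.NavierStokesRegularity.NavierStokesRegularity.Theorems.AxisTwistDoorAveragedConeLiouvilleShellSupersolution
import Summits.NavierStokesRegularity.NavierStokesRegularity.Theorems.AxisTwistDoorAveragedConeLiouvilleHarnackChain

/-!
# Route `AxisTwistDoor` — crux `AveragedConeLiouville` (stmt-NavierStokesRegularity-26889): the CONDITIONAL closing theorem
# of the line `lrt_shell` (LEAD ns-atd-p1 g0 with width seats ns-ezl-w3, ns-el-k1b, ns-cas-k2, ns-in-wu-341 and typers g22–g24)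

`averagedConeLiouville_of_facts`: the crux `AveragedConeLiouville` — a Type-I ancient Oseen-mild divergence-free profile of the route's
energy class (suitable on the backward slab, weak gradient, `𝐈 < ∞`) with `⟪curl v, e₃⟫ ≥ 0` everywhere and CIRCLE-AVERAGED tilt
domination on the unit cylinder is NOT backward singular at the apex — GIVEN the two TYPED LITERATURE FACTS
`Literature.Analysis.FluidPDE.LeiRen2024_quantitative_regular_shells_cyl` (Lei–Ren, Adv. Math. 445 (2024) 109654, Thm 2/Rem 8/Prop 9
= Lei–Ren–Tian arXiv:2501.08976 Lemma 2.4; cite item wi-87109) and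
`Literature.Analysis.FluidPDE.NazarovUraltseva2011_positivity_propagation` on `ℝ³` (Nazarov–Ural'tseva, Algebra i Analiz 23 (2011),
Cor. 3.2 = LRT Lemma 2.5; cite item wi-87110), neither of which is proved in the tree.  Hence this is a CONDITIONAL RESULT: its type is
`LeiRen… → NazarovUraltseva… → AveragedConeLiouville`, not the crux itself; the item stays open, blocked on those two facts.

The proof is the skeleton of record `Cruxes/AveragedConeLiouville/Lines/lrt_shell.lean` (v7) composed BY NAME from the landed stubs:
(0) zoom to a slack-free globally coned singular class profile (ns-el-k1b `…ProfileZoom.zoomToSlackFree`); (1) the circle-averaged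
swirl identity (ns-ezl-w3 `…CircleSwirl.stub_circleSwirl`); (2) the circle toolkit (LEAD `…CircleToolkit.stub_circleToolkit`);
(3b) the class-specialised quantitative regular shell from Lei–Ren (ns-cas-k2 `…ShellBookkeeping.shellFact_of_leiRen_of_core` with
ns-in-wu-341 `…ShellCore.shellCore_of_class`); (4b) the classical closed-cylinder positivity propagation from Nazarov–Ural'tseva
(ns-in-wu-341 `…PositivityOfNU.stub_positivityOfNU`, typer g24 `….classical`); (5) flux decay at the apex = scale iteration (LEAD F1
`…FluxIteration`) ∘ Navier–Stokes rescaling (LEAD F2 `…Rescale.fluxDecay_of_unitContraction`) ∘ the one-scale contraction (LEAD F4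
`…UnitContraction.unitContraction_of`) from the fluid → PDE data (ns-el-k1b `…ShellBound.stub_shellSupersolution`, on LEAD F3
`…Gamma34`, toolkit, CircMonotone) and the Harnack chain (ns-in-wu-341 `…HarnackChain.axisHarnackChain`, on LEAD H1 `…AxisLift`,
H2 `…PositivityAffine`, ns-cas-k2 `…RadialDrift`/`…MeridianLaplacian`); (6) regularity of the apex from flux decay (ns-el-k1b
`…ProfileZoom.stub_regularOfFluxDecay`, second zoom + rigidity) — contradiction with the persisted singularity.
Mathematics: Lei–Ren–Tian arXiv:2501.08976 §4 (eqs. Gamma-30, Gamma-34, Gamma-sigma-iter) transplanted to the one-signed,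
circle-averaged setting; the flux upper bound is free (`Γ = ∮v·e_θ ≤ 2πaB` on the shell + monotonicity in `r`).

WHAT THIS IS NOT: not a proof of Navier–Stokes regularity (Clay A), not even of the leaf `HalfSpaceWindowDoor.Target`: a CONDITIONAL
regularity criterion about HYPOTHETICAL Type-I blow-up profiles; the route's research crux `TiltDominationLoc` (26991, XL) is OPEN.
-/

noncomputable section

set_option linter.dupNamespace false

namespace Summit.NavierStokesRegularity.NavierStokesRegularity.Theorems.AxisTwistDoorAveragedConeLiouville

open Summit.NavierStokesRegularity.NavierStokesRegularity.Theorems.AxisTwistDoorAveragedConeLiouvilleDefs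
open Summit.NavierStokesRegularity.NavierStokesRegularity.Theorems

/-- **`AveragedConeLiouville` GIVEN Lei–Ren 2024 (quantitative regular shells) and Nazarov–Ural'tseva 2011 (positivity propagation)**
— conditional closing theorem of the line `lrt_shell` of crux stmt-NavierStokesRegularity-26889 (skeleton v7 composed by name).
[conditional on: `LeiRen2024_quantitative_regular_shells_cyl`, `NazarovUraltseva2011_positivity_propagation (E := ℝ³)`] -/
theorem averagedConeLiouville_of_facts
    (h₁ : Literature.Analysis.FluidPDE.LeiRen2024_quantitative_regular_shells_cyl)
    (h₂ : Literature.Analysis.FluidPDE.NazarovUraltseva2011_positivity_propagation (E := EuclideanSpace ℝ (Fin 3))) :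
    Summit.NavierStokesRegularity.NavierStokesRegularity.Theses.AxisTwistDoor.AveragedConeLiouville := by
  intro C v π H hdecay hcont hmild hdiv hsw hwg hI hnn hKM hsing
  obtain ⟨C', v', π', H', ⟨hdecay', hcont', hmild', hdiv'⟩, ⟨hsw', hwg', hI'⟩, hsing', hnn', hK'⟩ :=
    AveragedConeLiouvilleProfileZoom.zoomToSlackFree C v π H hdecay hcont hmild hdiv hsw hwg hI hnn hKM hsing
  have hcl' : InClass C' v' π' H' := ⟨hdecay', hcont', hmild', hdiv', hsw', hwg', hI'⟩
  have hShell : ShellFact :=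
    AveragedConeLiouville.ShellBookkeeping.shellFact_of_leiRen_of_core h₁ AveragedConeLiouville.ShellCore.shellCore_of_class
  have hPos : PositivityPropagationFactC := AveragedConeLiouville.PositivityOfNU.stub_positivityOfNU h₂
  have hFlux : FluxDecay v' :=
    AxisTwistDoorAveragedConeLiouvilleRescale.fluxDecay_of_unitContraction
      (AxisTwistDoorAveragedConeLiouvilleUnitContraction.unitContraction_of AveragedConeLiouville.ShellBound.stub_shellSupersolution
        AveragedConeLiouville.HarnackChain.axisHarnackChain hShell hPos)
      C' v' π' H' hcl' hnn' hK'
  exact AveragedConeLiouvilleProfileZoom.stub_regularOfFluxDecay AveragedConeLiouville.CircleSwirl.stub_circleSwirl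
    AxisTwistDoorAveragedConeLiouvilleCircleToolkit.stub_circleToolkit hShell C' v' π' H' hcl' hnn' hK' hFlux hsing'

end Summit.NavierStokesRegularity.NavierStokesRegularity.Theorems.AxisTwistDoorAveragedConeLiouville

end
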